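/-
Copyright: seat `ym-line-cbag-p2` (prover-ym-line-cbag-p2-g0-0), route `ColdBoxAllGroups`, crux `BulkAllGroups`
(stmt-QuantumFields-22255), line `dlr-chessboard-G` (skeleton `Cruxes/BulkAllGroups/Lines/birth.lean`).
-/
import Summits.QuantumFields.YangMills.Theorems.ColdBoxAllGroupsBulkAllGroupsDlrPlumbingG

/-!
# Registered stub L3-G `stub_dlrAssemblyG : DlrAssemblyG` of crux `BulkAllGroups` (stmt-QuantumFields-22255), BY NAME —
# part 2 of 2: the DLR assembly for EVERY compact gauge group

WHAT.  `DlrAssemblyG` (module `ColdBoxAllGroupsDefs`, the line's L3-G, registered signature `DlrAssemblyG`): for every compact group `G`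
(Borel structure an instance), every faithful continuous unitary `r : LatticeRep G` and all real `A θ δ η₁ K` with `0 < A`, `0 < δ`,
`0 < η₁` and the window `K + 4δ + 2A < 2 + 2θ`,
`GoodBoundaryCovStableG r.ρ A θ δ η₁ → GoodBoundaryMeanSmoothG r.ρ A θ δ → PlaquetteLargeFieldRarityG r.ρ δ → BoxPolyFloorG r.ρ A θ K →
BulkDominatesBox r.ρ A θ`.  PROVED here (`stub_dlrAssemblyG`) with `η = η₁/2` — the G-port of the `SU(2)` stub `stub_dlrAssembly` (p448414):
part 1's `torusPlaqCov_eq_boxKernelG` writes the torus covariance through the box kernels; the `SU(2)` plumbing file's abstract law of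
total covariance `total_covariance_lower_bound_sub` (constant `K₀ = 2N`) with the exceptional event `{lift ∈ Bad}` (mass
`≤ 6(2H+3)⁴e^{−β^δ}` by L2-G, part 1's `measureReal_badSetG_le`; off it the datum is `CrudeGoodG`, so L1a-G gives `q − hk ≥ η₁·boxPlaqCov`
and L1b-G gives `|k − h| ≤ |K₁| β^{2δ−1} T/H`), then the window arithmetic `ε²/4 ≤ K₁² β^{4δ−2+2A−2θ} ≤ ¼η₁β^{−K}` and
`(8N²η₁ + 12N² + 1)·6·7⁴·β^{4|θ|}e^{−β^δ} ≤ ¼η₁β^{−K}` for `β ≥ β₀`, and `β^{−K} ≤ X = boxPlaqCov ≤ 8N²` (`BoxPolyFloorG`, part 1's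
`boxPlaqCov_le_sq`): `Cov_torus ≥ η₁X − ¼η₁X − ¼η₁X = (η₁/2)X`, eventually in `L`.

WHAT THIS IS NOT.  No analysis: L1a-G, L1b-G and `BoxPolyFloorG` (= BOX_G + FLOOR) are hypotheses of `DlrAssemblyG`.  NOT a claim about
the mass gap (the crux is a rung-level finite-volume comparison; the Yang–Mills mass gap is NOT proved by any of this).

References: H.-O. Georgii, *Gibbs Measures and Phase Transitions* (2011) Thm. 4.17; R. Durrett (2019) §4.1; E. Seiler, LNP 159 (1982) Ch. 2.
-/

set_option autoImplicit false

noncomputable section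

open MeasureTheory Filter Topology
open Literature.MathematicalPhysics
open Literature.MathematicalPhysics.QuantumFieldTheory
open Literature.MathematicalPhysics.QuantumLattice
open Literature.Probability.LatticeModels (Torus.proj box mem_box)
open Summit.QuantumFields.YangMills.Theorems.WeakCouplingRates

namespace Summit.QuantumFields.YangMills.Theorems.ColdBoxAllGroups

/-! ### §5. The registered stub L3-G -/

/-- **Registered stub `stub_dlrAssemblyG` of crux `stmt-QuantumFields-22255` (BULK, all `G`)** — L3-G of the `dlr-chessboard-G` line, by
name and signature: for every compact `G` and faithful continuous unitary `r`, the DLR law of total covariance with a crude-good/bad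
split of the boundary datum turns L1a-G (`GoodBoundaryCovStableG`), L1b-G (`GoodBoundaryMeanSmoothG`), L2-G (`PlaquetteLargeFieldRarityG`)
and the polynomial box floor (`BoxPolyFloorG`) into `BulkDominatesBox r.ρ A θ` with `η = η₁/2`, on the window `K + 4δ + 2A < 2 + 2θ`
(Georgii 2011 Thm. 4.17; Durrett 2019 §4.1).  G-port of `stub_dlrAssembly` (constants `2N`, `8N²` for `4`, `32`). [folklore] -/
theorem stub_dlrAssemblyG : DlrAssemblyG := by
  intro G _ _ _ _ _ _ r A θ δ η₁ K hA hδ hη₁ hwin h1a h1b h2 hK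
  obtain ⟨β₁, h1a⟩ := h1a
  obtain ⟨K₁, β₂, h1b⟩ := h1b
  obtain ⟨β₃, h2⟩ := h2
  obtain ⟨β₄, hK⟩ := hK
  haveI : SecondCountableTopology G := r.secondCountableTopology
  set ρ : G →* Matrix (Fin r.N) (Fin r.N) ℂ := r.ρ with hρdef
  have hρc : Continuous ρ := r.continuous
  have hρu : ∀ g, ρ g ∈ Matrix.unitaryGroup (Fin r.N) ℂ := r.mem_unitary
  set Nr : ℝ := (r.N : ℝ) with hNr
  have hNr : 0 ≤ Nr := Nat.cast_nonneg _
  -- the window gap and the two asymptotic thresholds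
  set g : ℝ := 2 + 2 * θ - K - 4 * δ - 2 * A with hg
  have hg0 : 0 < g := by rw [hg]; linarith
  have hA1ev : ∀ᶠ β : ℝ in atTop, 4 * K₁ ^ 2 * β ^ (-g) < η₁ := by
    have ht : Tendsto (fun β : ℝ => 4 * K₁ ^ 2 * β ^ (-g)) atTop (𝓝 (4 * K₁ ^ 2 * 0)) :=
      (tendsto_rpow_neg_atTop hg0).const_mul _
    rw [mul_zero] at ht
    exact ht.eventually (gt_mem_nhds hη₁)
  set Cbad : ℝ := (8 * Nr ^ 2 * η₁ + 12 * Nr ^ 2 + 1) * (6 * 2401) with hCbad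
  have hCbad0 : 0 < Cbad := by positivity
  have hA2ev : ∀ᶠ β : ℝ in atTop, Cbad * (β ^ (4 * |θ| + K) * Real.exp (-(β ^ δ))) < η₁ / 4 := by
    have ht := (tendsto_rpow_mul_exp_neg_rpow (4 * |θ| + K) hδ).const_mul Cbad
    rw [mul_zero] at ht
    exact ht.eventually (gt_mem_nhds (by positivity))
  obtain ⟨β₅, hβ₅⟩ := Filter.eventually_atTop.1 (hA1ev.and hA2ev)
  refine ⟨η₁ / 2, by positivity, max (max (max β₁ β₂) (max β₃ β₄)) (max β₅ 1), fun β hβ => ?_⟩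
  simp only [max_le_iff] at hβ
  obtain ⟨⟨⟨hb1, hb2⟩, hb3, hb4⟩, hb5, hb6⟩ := hβ
  have hβ0 : 0 < β := by linarith
  obtain ⟨hA1, hA2⟩ := hβ₅ β hb5
  set H : ℕ := ⌈β ^ θ⌉₊ with hH
  set T : ℕ := ⌈β ^ A⌉₊ with hT
  -- sizes of `H` and `T`
  have hT2 : (T : ℝ) ≤ 2 * β ^ A := (one_le_ceil_rpow_and_le hb6 hA.le).2
  have hθpos : 0 < β ^ θ := Real.rpow_pos_of_pos hβ0 θ
  have hHge : β ^ θ ≤ (H : ℝ) := Nat.le_ceil _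
  have hHpos : (0 : ℝ) < H := lt_of_lt_of_le hθpos hHge
  have hHle : (H : ℝ) ≤ β ^ |θ| + 1 := by
    have h1 : (H : ℝ) < β ^ θ + 1 := Nat.ceil_lt_add_one hθpos.le
    have h2 : β ^ θ ≤ β ^ |θ| := Real.rpow_le_rpow_of_exponent_le hb6 (le_abs_self θ)
    linarith
  have habs1 : (1 : ℝ) ≤ β ^ |θ| := Real.one_le_rpow hb6 (abs_nonneg θ)
  -- the box floor and the size of the box covariance
  have hXK : β ^ (-K) ≤ boxPlaqCov ρ β H T := hK β hb4
  have hXpos : 0 < boxPlaqCov ρ β H T := lt_of_lt_of_le (Real.rpow_pos_of_pos hβ0 _) hXK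
  have hX8 : boxPlaqCov ρ β H T ≤ 8 * Nr ^ 2 := boxPlaqCov_le_sq ρ hρc hρu β H T
  -- eventually in the torus size
  filter_upwards [h2 β hb3, eventually_gt_atTop (2 * (2 * H + T + 2))] with L hL2 hLbig
  haveI := isProbabilityMeasure_wilsonMeasure (d := 4) (L := L + 1) (G := G) ρ hρc β
  rw [torusPlaqCov_eq_boxKernelG ρ hρc hρu β (Nat.lt_succ_of_lt hLbig)]
  -- the kernel quantities
  set Λ : Finset (QuantumLattice.ZdEdge 4) := AxialGauge.boxEdges 4 (2 * H + 1) with hΛ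
  set bc : Literature.Probability.LatticeModels.Site 4 := boxCentre H with hbc
  set v0 : Literature.Probability.LatticeModels.Site 4 := Pi.single 0 (T : ℤ) with hv0
  set cp : LGConfig 4 G → ℝ := plaqCostAt ρ bc 1 2 with hcp
  set cp' : LGConfig 4 G → ℝ := plaqCostAt ρ (bc + v0) 1 2 with hcp'
  set h : GaugeConfig 4 (L + 1) G → ℝ := fun U => ∫ W, cp W ∂(ymSpecification ρ β Λ (torusLift (L + 1) U)) with hh
  set k : GaugeConfig 4 (L + 1) G → ℝ := fun U => ∫ W, cp' W ∂(ymSpecification ρ β Λ (torusLift (L + 1) U)) with hk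
  set q : GaugeConfig 4 (L + 1) G → ℝ :=
    fun U => ∫ W, cp W * cp' W ∂(ymSpecification ρ β Λ (torusLift (L + 1) U)) with hq
  have hcpc : Continuous cp := continuous_plaqCostAtG ρ hρc bc 1 2
  have hcpc' : Continuous cp' := continuous_plaqCostAtG ρ hρc (bc + v0) 1 2
  have hcpK : ∀ U, |cp U| ≤ 2 * Nr := abs_plaqCostAt_leG ρ hρu bc 1 2
  have hcpK' : ∀ U, |cp' U| ≤ 2 * Nr := abs_plaqCostAt_leG ρ hρu (bc + v0) 1 2
  have hqc : Continuous fun U => cp U * cp' U := hcpc.mul hcpc'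
  have hqK : ∀ U, |cp U * cp' U| ≤ (2 * Nr) ^ 2 := abs_plaqCostAt_mul_leG ρ hρu bc (bc + v0) 1 2
  have hml := measurable_torusLift (d := 4) (G := G) (L + 1)
  have hhm : Measurable h := (continuous_integral_ymSpecification ρ hρc β Λ hcpc hcpK).measurable.comp hml
  have hkm : Measurable k := (continuous_integral_ymSpecification ρ hρc β Λ hcpc' hcpK').measurable.comp hml
  have hqm : Measurable q := (continuous_integral_ymSpecification ρ hρc β Λ hqc hqK).measurable.comp hml
  have hhK : ∀ U, |h U| ≤ 2 * Nr := fun U => abs_integral_ymSpecification_le ρ hρc β Λ hcpK _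
  have hkK : ∀ U, |k U| ≤ 2 * Nr := fun U => abs_integral_ymSpecification_le ρ hρc β Λ hcpK' _
  have hqK' : ∀ U, |q U| ≤ (2 * Nr) ^ 2 := fun U => abs_integral_ymSpecification_le ρ hρc β Λ hqK _
  -- the bad event and its mass
  set E : Set (GaugeConfig 4 (L + 1) G) := {U | torusLift (L + 1) U ∈
      ⋃ z ∈ (Fintype.piFinset fun _ : Fin 4 => Finset.Icc (-1 : ℤ) (2 * (H : ℤ) + 1)) ×ˢ
          ((Finset.univ : Finset (Fin 4 × Fin 4)).filter fun q => q.1 < q.2),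
        {W : LGConfig 4 G | β ^ (2 * δ - 1) < plaqCostAt ρ z.1 z.2.1 z.2.2 W}} with hE
  have hEm : MeasurableSet E := hml (measurableSet_badSetG ρ hρc β δ H)
  have hgood : ∀ U, U ∉ E → CrudeGoodG ρ β δ H (torusLift (L + 1) U) := fun U hU => crudeGoodG_of_not_mem_badSet ρ hU
  set p : ℝ := ((6 * (2 * H + 3) ^ 4 : ℕ) : ℝ) * Real.exp (-(β ^ δ)) with hp
  have hμE : (wilsonMeasure (d := 4) (L := L + 1) ρ β).real E ≤ p := measureReal_badSetG_le ρ hρc hL2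
  -- the conditional covariance (L1a-G) and the mean difference (L1b-G) off the bad event
  set X : ℝ := boxPlaqCov ρ β H T with hXdef
  have hθl : 0 ≤ η₁ * X := by positivity
  set ε : ℝ := |K₁| * β ^ (2 * δ - 1) * T / H with hε
  have hlow : ∀ U, U ∉ E → η₁ * X ≤ q U - h U * k U := fun U hU => h1a β hb1 _ (hgood U hU)
  have hdiff : ∀ U, U ∉ E → |k U - h U| ≤ ε := fun U hU => by
    have h0 := h1b β hb2 _ (hgood U hU)
    refine h0.trans ?_
    rw [hε]
    have hnum : 0 ≤ β ^ (2 * δ - 1) * T / H := by positivity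
    have e1 : K₁ * β ^ (2 * δ - 1) * ↑T / ↑H = K₁ * (β ^ (2 * δ - 1) * T / H) := by ring
    have e2 : |K₁| * β ^ (2 * δ - 1) * ↑T / ↑H = |K₁| * (β ^ (2 * δ - 1) * T / H) := by ring
    rw [e1, e2]
    exact mul_le_mul_of_nonneg_right (le_abs_self K₁) hnum
  have key := total_covariance_lower_bound_sub hEm hhm hkm hqm hhK hkK hqK' hθl hlow hdiff hμE
  -- window arithmetic: the `ε²/4` term
  have hεX : ε ^ 2 / 4 ≤ η₁ / 4 * X := by
    have hε0 : 0 ≤ ε := by rw [hε]; positivity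
    have hεle : ε ≤ 2 * |K₁| * β ^ (2 * δ - 1 + A - θ) := by
      calc ε = |K₁| * β ^ (2 * δ - 1) * T / H := hε
        _ ≤ |K₁| * β ^ (2 * δ - 1) * (2 * β ^ A) / β ^ θ := by
            have hnum : |K₁| * β ^ (2 * δ - 1) * ↑T ≤ |K₁| * β ^ (2 * δ - 1) * (2 * β ^ A) :=
              mul_le_mul_of_nonneg_left hT2 (by positivity)
            calc |K₁| * β ^ (2 * δ - 1) * ↑T / ↑H ≤ |K₁| * β ^ (2 * δ - 1) * ↑T / β ^ θ :=
                  div_le_div_of_nonneg_left (by positivity) hθpos hHge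
              _ ≤ |K₁| * β ^ (2 * δ - 1) * (2 * β ^ A) / β ^ θ := div_le_div_of_nonneg_right hnum hθpos.le
        _ = 2 * |K₁| * β ^ (2 * δ - 1 + A - θ) := by
            rw [Real.rpow_sub hβ0 (2 * δ - 1 + A) θ, Real.rpow_add hβ0 (2 * δ - 1) A]
            field_simp
    have hsq : ε ^ 2 ≤ (2 * |K₁| * β ^ (2 * δ - 1 + A - θ)) ^ 2 := pow_le_pow_left₀ hε0 hεle 2
    have hexp : (2 * |K₁| * β ^ (2 * δ - 1 + A - θ)) ^ 2 = 4 * K₁ ^ 2 * β ^ (-g) * β ^ (-K) := by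
      have e2 : (β ^ (2 * δ - 1 + A - θ)) ^ 2 = β ^ (-g) * β ^ (-K) := by
        rw [← Real.rpow_natCast (β ^ (2 * δ - 1 + A - θ)) 2, ← Real.rpow_mul hβ0.le, ← Real.rpow_add hβ0]
        congr 1
        rw [hg]; push_cast; ring
      calc (2 * |K₁| * β ^ (2 * δ - 1 + A - θ)) ^ 2 = 4 * |K₁| ^ 2 * (β ^ (2 * δ - 1 + A - θ)) ^ 2 := by ring
        _ = 4 * K₁ ^ 2 * (β ^ (-g) * β ^ (-K)) := by rw [sq_abs, e2]
        _ = 4 * K₁ ^ 2 * β ^ (-g) * β ^ (-K) := by ring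
    have h3 : 4 * K₁ ^ 2 * β ^ (-g) * β ^ (-K) ≤ η₁ * β ^ (-K) :=
      mul_le_mul_of_nonneg_right hA1.le (Real.rpow_nonneg hβ0.le _)
    have h4 : η₁ * β ^ (-K) ≤ η₁ * X := mul_le_mul_of_nonneg_left hXK hη₁.le
    linarith
  -- window arithmetic: the bad-event term
  have hpX : (η₁ * X + 3 * (2 * Nr) ^ 2) * p ≤ η₁ / 4 * X := by
    have hp0 : 0 ≤ p := by positivity
    have hcoef : η₁ * X + 3 * (2 * Nr) ^ 2 ≤ 8 * Nr ^ 2 * η₁ + 12 * Nr ^ 2 + 1 := by nlinarith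
    have hH4 : ((6 * (2 * H + 3) ^ 4 : ℕ) : ℝ) ≤ 6 * 2401 * β ^ (4 * |θ|) := by
      have h7 : (2 * (H : ℝ) + 3) ≤ 7 * β ^ |θ| := by linarith
      have h74 : (2 * (H : ℝ) + 3) ^ 4 ≤ (7 * β ^ |θ|) ^ 4 := pow_le_pow_left₀ (by positivity) h7 4
      have e4 : (β ^ |θ|) ^ 4 = β ^ (4 * |θ|) := by
        rw [← Real.rpow_natCast (β ^ |θ|) 4, ← Real.rpow_mul hβ0.le]; norm_num; ring_nf
      push_cast
      rw [mul_pow, e4] at h74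
      linarith
    have hsplit : β ^ (4 * |θ|) = β ^ (4 * |θ| + K) * β ^ (-K) := by
      rw [← Real.rpow_add hβ0]; ring_nf
    calc (η₁ * X + 3 * (2 * Nr) ^ 2) * p ≤ (8 * Nr ^ 2 * η₁ + 12 * Nr ^ 2 + 1) * p := mul_le_mul_of_nonneg_right hcoef hp0
      _ ≤ (8 * Nr ^ 2 * η₁ + 12 * Nr ^ 2 + 1) * (6 * 2401 * β ^ (4 * |θ|) * Real.exp (-(β ^ δ))) := by
          refine mul_le_mul_of_nonneg_left ?_ (by positivity)
          exact mul_le_mul_of_nonneg_right hH4 (Real.exp_pos _).le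
      _ = Cbad * (β ^ (4 * |θ| + K) * Real.exp (-(β ^ δ))) * β ^ (-K) := by rw [hsplit, hCbad]; ring
      _ ≤ η₁ / 4 * β ^ (-K) := mul_le_mul_of_nonneg_right hA2.le (Real.rpow_nonneg hβ0.le _)
      _ ≤ η₁ / 4 * X := mul_le_mul_of_nonneg_left hXK (by positivity)
  -- conclusion
  have hgoal : η₁ / 2 * X ≤ (∫ U, q U ∂(wilsonMeasure (d := 4) (L := L + 1) ρ β)) -
      (∫ U, h U ∂(wilsonMeasure (d := 4) (L := L + 1) ρ β)) * ∫ U, k U ∂(wilsonMeasure (d := 4) (L := L + 1) ρ β) := by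
    linarith
  exact hgoal

end Summit.QuantumFields.YangMills.Theorems.ColdBoxAllGroups

end
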